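/-
Copyright (c) 2026 the pub-hodgecm-mathlib formalisation cell (harness21).  Prover seats hodgecm-mathlib-LA1-p04 (g3) (★ `RoofLegsSpecialFibreKernelRowsFin`, the kernel ∕
degree ∕ finiteness rows) and A-p06 (g36∕g37) (★ `RoofLegsSpecialFibreKernelRowsImage` §0 + (IMG-gen); THIS merged edition: A-p06 (g37), L2 (ρ1𝒞) body — ONE reduced leg
with the Fin rows AND the image row, RULING (γ1)); 2026-09-02.
-/
import Literature.AlgebraicGeometry.AbelianSchemes.RoofLegsSpecialFibreKernelRowsDeg
import Literature.AlgebraicGeometry.AbelianSchemes.AbelianSchemeHomReductionSpecialFibreKernelRowsFinImage   -- the FIN+IMAGE producing head (A-p06 (g37))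
import Literature.AlgebraicGeometry.AbelianSchemes.RoofLegsSpecialFibreKernelRowsImage                        -- §0 `pullback_map_baseChangeHom_comp_threePiece_inv` (A-p06 (g36) p850875)
import Literature.AlgebraicGeometry.GroupSchemes.EtaleKernelDecidedOnPoints
import HarnessLib

/-!
# THE LEGS OF THE DOWNSTAIRS ROOF WITH THE KERNEL ROWS (K3)(K2), DEGREE (K4), FINITENESS (FIN), RANK (RK) AND THE IMAGE ROW (IMG-gen) OF ONE REDUCED LEG
# — FIN + IMAGE EDITION ([SerreTate1968] §1 Lemma 2; [Liu2021] Prop. D.8; [BoschLutkebohmertRaynaud1990] §2.5 Prop. 2, §7.3 Prop. 6)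

Topic `AlgebraicGeometry/AbelianSchemes`, namespace `Literature.AlgebraicGeometry.AbelianSchemes.AbelianSchemeOver`.  THEOREMS ONLY (no definition, no named fact,
no `instance`, no notation, no `sorry`).  Cell `hodgecm-mathlib` (D-0151), F0∕P6 «MOD», «GO 500» half A line L3 (socket `stub_FROB` of the D-line
`Cruxes/HLiu418/Lines/F0_P6a_DatumOfInputs.lean`, road ROOF → `stub_ROOF0`), RULING (γ1) «ONE ∃, ONE ROOF DOWNSTAIRS»: the reduced leg `q̄` of the ROOF-LEGS leaflet is ONE
∃-witness, so every kernel fact about it must be exported as a ROW by the producing organ.  This file is ★ `RoofLegsSpecialFibreKernelRowsDeg`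
(p850117; = ★ organ #3-bis p849660 + (K3-gen)(K2-gen)(K4-gen)) VERBATIM with the ONE reduction call re-pointed to ★ `exists_specialFibre_hom_reduction_kerRowsFin` and TWO more
exported rows **(FIN)** «`IsFinite qbar.left`» (the reduced leg is an isogeny, not only flat surjective) and **(RK)** «`Module.finrank κ̄ (Alg (Ker q̄)) = #Ker q(Ω̄)`» (★
`finrank_alg_ker_eq_natCard_kerPoints_of_kerRank_eq` applied INSIDE to (K4-gen) + (FIN) + (r1₀)); the earlier extra row **(K4-gen)** «`kerRank (homOfIsMonHom q̄) = kerRank (homOfIsMonHom q)`» — the DEGREE of the reduced leg is the degree of the leg (`q′ = q ≫ E⁻¹` has `q`'s degree,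
`E` an isomorphism; the head's (K4) carries `deg q′` to `deg q̄` along the turnkey's Dedekind stage).  The earlier rows, for THE SAME `q̄`: **(K3-gen)** for every flat `𝒦 ↪ 𝒜_x̃` over the valuation ring `R = 𝒪_Ω̄` (`x̃ := extendPoint …` the `R`-point extending `x`; three-piece isomorphisms of ★ (d5) written
explicitly, as ★ (ν8R)): if the leg `q : 𝒜_x → B` kills `𝒦_η` then `q̄` kills `𝒦_s` (the head's row is for `q′ = q ≫ E⁻¹`; `E` is an isomorphism); **(K2-gen)** for every
ideal `𝔞` of `𝒪`: if every `Ω̄`-POINT of `𝒜_x` killed by `q` is killed by `ι(𝔞)`, then every `T`-valued point of `𝒜_{x̄}` killed by `q̄` is killed by `ι(𝔞)` (the head's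
row (K2) wants the premiss on all `T`-points upstairs; `q′` is an isogeny over `Ω̄` of characteristic `0`, so ★ `comp_eq_one_of_forall_points_of_charZero` upgrades the
`Ω̄`-points premiss).

WHY ([Liu2021] Prop. D.8 p. 135, pp. 136–138; LA3-plan (g2) (hker-DOWN)∕(K-ROWS)): the block-law assembly at `x̄` (★ `FrobeniusKernelLawBlockAssembly`, `hker`) needs
`Ker q̄ ⊆ 𝒜_{x̄}[𝔭_w·𝔭_{c•w}]`; upstairs `Ker q = K ⊆ 𝒜_y[𝔭_w·𝔭_{c•w}]` on `Ω̄`-points is the support clause of the Hecke translate (L2's ★ `isIdealTorsion_mul_of_roof`), and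
(K2-gen) at `𝔞 := 𝔭_w·𝔭_{c•w}` carries it downstairs; (K3-gen) serves the (ρ1)-rebased `spGeoOf` kernel reading at `𝒦 :=` the saturated closure of a line.
WHY (K4): road (ρ-up) of the `w`-block numerics — `rk Γ(Ker q̄) = deg q̄ = deg q = #K(Ω̄) = q²` (LA3-p03 (g3) census 2026-09-02T06:55:43Z: the ONE residual row
`rk Γ(Ker q̄) = q²`; the last equality is L2's roof degree chain ∕ letter, LEAD's call (A)∕(B)).  Consumer: the ROOF-LEGS leaflet ED. 2 (LA3-p01), ONE switch to this head BY NAME.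

ED. 2 (same seat, same day; append-only): `exists_roofLeg_specialFibre_of_downstairsDual_kerRowsLite` = the same ∃ minus (K3-gen) (for the Lines-side consumer, where (K3-gen)'s statement is
too costly to elaborate at the D-line carriers).

HONEST LABEL: HC_CM is proved only modulo the cell's 2 remaining named inputs (hLiu418 24832, h413 24833) until rung 0 closes; generic capital on
`--supports stmt-HodgeConjecture-24832`, pays no letter.

## References
FIN + IMAGE EDITION (this file, A-p06 (g37)): = ★ `RoofLegsSpecialFibreKernelRowsFin` BY COPY (binders, rows (r1₀)(r4₀-q)(r5₀-q)(r3₀-q)(K3-gen)(K2-gen)(K4-gen)(FIN)(RK)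
and their proofs byte-identical; the ED. 2 `…Lite` corollary is NOT repeated), head renamed **`exists_roofLeg_specialFibre_of_downstairsDual_kerRowsFin_image`**, the ONE
reduction call re-pointed to ★ `exists_specialFibre_hom_reduction_kerRowsFin_image` (same rows + (v-c)), and ONE more exported row, LAST, for THE SAME `q̄`: **(IMG-gen)** — the
text and the proof of ★ `RoofLegsSpecialFibreKernelRowsImage` (A-p06 (g36): the head's (v-c) for `q′ = q ≫ E⁻¹` at `ζ ≫ c̄_R`, its §0 naturality
`pullback_map_baseChangeHom_comp_threePiece_inv` IMPORTED, `c̄_{x″} ≫ E = c`) VERBATIM.  WHY: the L2 (ρ1𝒞) body `exists_quotLegReduction_of_legs` names ONE reduced leg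
`ψ := (…).choose`; its rows (RK)∕(DOCK) consume (K4)(FIN)(RK) and its row (IMG) consumes (IMG-gen) — of the SAME witness (LA1-plan (g5) ∕ LA2-plan (g2) 2026-09-02T11:1xZ).
Consumer: the (ρ1𝒞) (b‴) block at the D-line carriers (`exists_roofLeg_of_legs_kerRowsFin_image`), then `row_IMG` (§ IMG leaflet `himg_spGeoOf_of_roofRows`).

* [SerreTate1968] J.-P. Serre, J. Tate, *Good reduction of abelian varieties*, Ann. of Math. 88 (1968), §1 (Lemma 2, Theorem 1).
* [BoschLutkebohmertRaynaud1990] S. Bosch, W. Lütkebohmert, M. Raynaud, *Néron Models* (1990), §1.2 Prop. 8, §7.1 Lemma 5 ∕ Prop. 6, §7.3 Prop. 6 (p. 180).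
* [MumfordAV1970] D. Mumford, *Abelian Varieties* (1970), §7 Thm. 4 (p. 72), §15 Thm. 1 (p. 143), §23 Thm. 2 (p. 231).
* [Conrad2004GrossZagier] B. Conrad, *Gross–Zagier revisited*, MSRI Publ. 49 (2004), §7 (Thm. 7.5).
* [Liu2021] Y. Liu, *Fourier–Jacobi cycles and arithmetic relative trace formula*, Camb. J. Math. 9 (2021), Appendix D, Prop. D.8 (p. 135), pp. 136–138.
* [GortzWedhorn2020] U. Görtz, T. Wedhorn, *Algebraic Geometry I*, 2nd ed. (2020), Definition 4.45 (2) (p. 117); Section (4.7) (p. 135); Prop. 9.19, Rem. 9.20.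
* [GortzWedhorn2023] U. Görtz, T. Wedhorn, *Algebraic Geometry II* (2023), Cor. 27.177 (1) (the rank of `Ker f` is locally constant).
-/

set_option autoImplicit false

noncomputable section

set_option backward.isDefEq.respectTransparency false

open CategoryTheory CategoryTheory.Limits AlgebraicGeometry MonoidalCategory CartesianMonoidalCategory
open scoped MonObj CategoryTheory.Obj NumberField
open Literature.AlgebraicGeometry.Motives
open IsDedekindDomain IsDedekindDomain.HeightOneSpectrum ValuativeRel
open Literature.NumberTheory.EllipticCurves (genericFibre specGenericPoint)
open Literature.NumberTheory.GaloisRepresentations (closureValuationSubring)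
open Literature.NumberTheory.DiophantineGeometry

namespace Literature.AlgebraicGeometry.AbelianSchemes

namespace AbelianSchemeOver

universe u

section DegreeBookkeeping

/-! ### §0 Bookkeeping: a morphism of abelian varieties with invertible underlying scheme morphism is an isogeny of degree `1` (as ★ (ν8d) §0, private there) -/

/-- A morphism of abelian varieties whose underlying scheme morphism is an isomorphism is an isogeny of degree `1`. [cite: GortzWedhorn2023, Cor. 27.177 (1)] -/
private theorem isIsogeny_and_kerRank_of_isIso_toSchemeHom_fi {k : Type u} [Field k] {X Y : AbelianVariety k} (φ : X ⟶ Y)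
    [IsIso (AbelianVariety.Hom.toSchemeHom φ)] : AbelianVariety.IsIsogeny φ ∧ AbelianVariety.Hom.kerRank φ = 1 := by
  have hI : AbelianVariety.IsIsogeny φ := ⟨inferInstance, inferInstance⟩
  refine ⟨hI, ?_⟩
  rw [← hI.finrank_eq_kerRank (genericPoint Y.X.left)]
  exact congrFun (Scheme.Hom.finrank_eq_one_of_isIso (AbelianVariety.Hom.toSchemeHom φ)) _

end DegreeBookkeeping

section HeadFinImage

variable {K : Type} [Field K] [NumberField K] {v : HeightOneSpectrum (𝓞 K)} {Y : SchemeOver K}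
  (𝓨 : IntegralModel (valuationSubringAtPrime K v) K Y) [IsProper 𝓨.total.hom]
  {𝒜 : AbelianSchemeOver 𝓨.total.left} {O : Type} [CommRing O] (act : 𝒜.RingAction O) [IsCommMonObj 𝒜.X]
  {m : ℕ} (E' : Matrix (Fin m) (Fin m) O) (hE' : E' * E' = E') (P : Matrix (Fin m) (Fin 1) O) (Q : Matrix (Fin 1) (Fin m) O) {N : ℕ}
  (x x'' : AlgPoints Y (AlgebraicClosure (v.adicCompletion K)))
  (D : 𝒜.DualPair)
  (hD : Nonempty ((Scheme.Modules.pullback (DualPair.unitHatSlice D)).obj D.P ≅ SheafOfModules.unit _))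
  (pol : 𝒜.Polarization D)

include hD in
set_option maxHeartbeats 800000 in
/-- **THE LEGS OF THE DOWNSTAIRS ROOF, THROUGH `𝒜`, WITH THE KERNEL ROWS (K3)(K2), THE DEGREE ROW (K4), FINITENESS (FIN) AND THE RANK COUNT (RK) OF THE REDUCED LEG** (★ organ #3-bis `exists_roofLeg_specialFibre_of_downstairsDual`
VERBATIM — binders and rows (r1₀)(r4₀-q)(r5₀-q)(r3₀-q) — plus five rows; (K4-gen): `kerRank (homOfIsMonHom q̄) = kerRank (homOfIsMonHom q)`, (FIN): `IsFinite qbar.left`,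
(RK): `Module.finrank κ̄ (Alg (ker q̄)) = Nat.card (Hom.kerPoints (specOver Ω̄ Ω̄) (homOfIsMonHom q))`;
[cite: BoschLutkebohmertRaynaud1990, §7.3 Prop. 6 (p. 180)]): from an UPSTAIRS roof `𝒜_x —q→ B ←c— 𝒜_{x″}` at
`x, x″ ∈ Y(Ω̄)` with `q` finite surjective, `c` surjective with `Ker c(Ω̄) = 𝒜_{x″}[𝔭](Ω̄)`, a dual pair `DB` (unit pin) and a dual homomorphism `λ_B` with `q^*λ_B = N·λ_x`,
`c^*λ_B = N·λ_{x″}`, common intertwiners and matching section values, THERE IS **`q̄ : (𝒜 ×_𝓨 𝓨_s)_{x̄} → (𝒞 ×_𝓨 𝓨_s)_{x̄″}`** (`𝒞 = 𝒜 ⊗_𝒪 𝔟` the Serre family of `(E′, P, Q, N)`)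
with (r1₀) flat + surjective, (r4₀-q) `ι_{x̄}(a) ≫ q̄ = q̄ ≫ ι^𝒞_{x̄″}(a)`, (r5₀-q) `q̄(τ_i(x̄)) = (τ_i ≫ ψ_P)(x̄″)`, and **(r3₀-q) FOR EVERY downstairs dual pair `DB̄` of `𝒞_{x̄″}` (unit pin)
and every homomorphism `λ_B̄ : 𝒞_{x̄″} → B̄^` with `c̄ ≫ λ_B̄ ≫ c̄^∨ = λ_{x̄″} ≫ [N]` (`c̄ = ψ_P` at `x̄″`): `q̄ ≫ λ_B̄ ≫ q̄^∨ = λ_{x̄} ≫ [N]`.**  PROOF: ★ organ #2 (`E : 𝒞_{x″} ≅ B`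
under `𝒜_{x″}`, `q′ := q ≫ E⁻¹`), ★ (ν8h) `exists_specialFibre_hom_reduction_comp` ONCE for `q′`; (r4₀)(r5₀) as ★ organ #3; (r3₀-q): `d := E⁻¹ ≫ ψ′_{x″}` has `c ≫ d = [N]`,
`d ≫ c = [N]`, so §1 gives the law of `q′ ≫ ψ′_{x″} = q ≫ d` through `𝒜`'s polarisation with scalar `N²`, (iv-h) transfers it to `q̄ ≫ ψ′_{x̄″}`, and §1 divides downstairs
against `λ_B̄` (quasi-inverse ★ `dualIsogenyOver_coverLeg_comp_eq_pow_id`).  **KERNEL ROWS (this file)**, for THE SAME `q̄` (one call of ★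
`exists_specialFibre_hom_reduction_kerRows` instead of ★ (ν8h)): (K3-gen) for every flat `𝒦 ↪ 𝒜_x̃` over `R = 𝒪_Ω̄` (`x̃` the `R`-point extending `x`), `q` kills `𝒦_η` ⇒ `q̄`
kills `𝒦_s` (three-piece isomorphisms of ★ (d5) explicit, as ★ (ν8R)); (K2-gen) for every ideal `𝔞`, `Ker q(Ω̄) ⊆ 𝒜_x[𝔞](Ω̄)` on `Ω̄`-POINTS ⇒ `Ker q̄ ⊆ 𝒜_{x̄}[𝔞]` on ALL
`T`-points (`q′` is an isogeny in characteristic `0`, so its kernel is decided on `Ω̄`-points, ★ `comp_eq_one_of_forall_points_of_charZero`). [cite: SerreTate1968, §1 Lemma 2] [cite: BoschLutkebohmertRaynaud1990, §1.2 Prop. 8 and §7.3 Prop. 6 (p. 180)]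
[cite: MumfordAV1970, §7 Thm. 4 (p. 72), §15 Thm. 1 (p. 143), §23 Thm. 2 (p. 231)] [cite: Conrad2004GrossZagier, §7 (Thm. 7.5)]   **IMAGE ROW (this edition)**: (IMG-gen) for every flat `𝒦 ↪ 𝒜_x̃` and every `ζ : 𝒵 → 𝒜_x̃″` with `ζ ≫ (ψ_P ×_𝓨 x̃″)` a closed
immersion, `incl_η ≫ e⁻¹ ≫ q` factors through `ζ_η ≫ e⁻¹ ≫ c` ⇒ `incl_s̄ ≫ e⁻¹ ≫ q̄` factors through `ζ_s̄ ≫ e⁻¹ ≫ c̄_{x̄″}` — for THE SAME `q̄` as (K4)(FIN)(RK).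
[cite: BoschLutkebohmertRaynaud1990, §2.5 Prop. 2] [cite: GortzWedhorn2020, Prop. 9.19, Rem. 9.20 and Section (4.7) (p. 135)] -/
theorem exists_roofLeg_specialFibre_of_downstairsDual_kerRowsFin_image
    (hN : N ≠ 0) (hP : E' * P = P) (hQ : Q * E' = Q)
    (hQP : Q * P = Matrix.scalar (Fin 1) (N : O)) (hPQ : P * Q = Matrix.scalar (Fin m) (N : O) * E')
    {𝔭 : Ideal O} (h𝔭 : Ideal.span (Set.range fun k => P k 0) = 𝔭)
    {J : Type*} (τ : J → 𝒜.Sections)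
    -- the upstairs roof at `x, x″`
    {B : AbelianSchemeOver (Spec (.of (AlgebraicClosure (v.adicCompletion K))))}
    (q : ((𝒜.baseChange (𝓨.genericIso'.inv.left ≫ pullback.fst 𝓨.total.hom (specGenericPoint (valuationSubringAtPrime K v) K))).baseChange x.left).X ⟶ B.X)
    [IsMonHom q] [IsFinite q.left] [Surjective q.left]
    (c : ((𝒜.baseChange (𝓨.genericIso'.inv.left ≫ pullback.fst 𝓨.total.hom (specGenericPoint (valuationSubringAtPrime K v) K))).baseChange x''.left).X ⟶ B.X)
    [IsMonHom c] [Surjective c.left]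
    -- (r2) the kernel of `c` on `Ω̄`-points is the `𝔭`-torsion
    (hker : ∀ Pt : ((𝒜.baseChange (𝓨.genericIso'.inv.left ≫ pullback.fst 𝓨.total.hom (specGenericPoint (valuationSubringAtPrime K v) K))).baseChange
        x''.left).toAffine.toAbelianVariety.Points (AlgebraicClosure (v.adicCompletion K)),
      (AlgPoints.map c Pt : B.toAffine.toAbelianVariety.Points (AlgebraicClosure (v.adicCompletion K))) = 1 ↔
        ∀ a ∈ 𝔭, (AlgPoints.map (((act.baseChange (𝓨.genericIso'.inv.left ≫ pullback.fst 𝓨.total.hom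
            (specGenericPoint (valuationSubringAtPrime K v) K))).baseChange x''.left).i a) Pt :
          ((𝒜.baseChange (𝓨.genericIso'.inv.left ≫ pullback.fst 𝓨.total.hom (specGenericPoint (valuationSubringAtPrime K v) K))).baseChange
            x''.left).toAffine.toAbelianVariety.Points (AlgebraicClosure (v.adicCompletion K))) = 1)
    -- (r3) the polarisation laws of the two legs through the dual homomorphism `λ_B`
    (DB : B.DualPair) (hDB : Nonempty ((Scheme.Modules.pullback (DualPair.unitHatSlice DB)).obj DB.P ≅ SheafOfModules.unit _))
    (lamB : B.X ⟶ DB.hat.X) [IsMonHom lamB]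
    (hq3 : q ≫ lamB ≫ DualPair.dualIsogenyOver q
        ((D.baseChange (𝓨.genericIso'.inv.left ≫ pullback.fst 𝓨.total.hom (specGenericPoint (valuationSubringAtPrime K v) K))).baseChange x.left) DB =
      ((pol.baseChange (𝓨.genericIso'.inv.left ≫ pullback.fst 𝓨.total.hom (specGenericPoint (valuationSubringAtPrime K v) K))).baseChange x.left).lam ≫
        ((D.baseChange (𝓨.genericIso'.inv.left ≫ pullback.fst 𝓨.total.hom (specGenericPoint (valuationSubringAtPrime K v) K))).baseChange x.left).hat.mulN N)
    (hc3 : c ≫ lamB ≫ DualPair.dualIsogenyOver c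
        ((D.baseChange (𝓨.genericIso'.inv.left ≫ pullback.fst 𝓨.total.hom (specGenericPoint (valuationSubringAtPrime K v) K))).baseChange x''.left) DB =
      ((pol.baseChange (𝓨.genericIso'.inv.left ≫ pullback.fst 𝓨.total.hom (specGenericPoint (valuationSubringAtPrime K v) K))).baseChange x''.left).lam ≫
        ((D.baseChange (𝓨.genericIso'.inv.left ≫ pullback.fst 𝓨.total.hom (specGenericPoint (valuationSubringAtPrime K v) K))).baseChange x''.left).hat.mulN N)
    -- (r4) common intertwiners
    (hb : ∀ a : O, ∃ b : B.X ⟶ B.X,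
      ((act.baseChange (𝓨.genericIso'.inv.left ≫ pullback.fst 𝓨.total.hom (specGenericPoint (valuationSubringAtPrime K v) K))).baseChange x.left).i a ≫ q =
          q ≫ b ∧
        ((act.baseChange (𝓨.genericIso'.inv.left ≫ pullback.fst 𝓨.total.hom (specGenericPoint (valuationSubringAtPrime K v) K))).baseChange x''.left).i a ≫ c =
          c ≫ b)
    -- (r5) level points correspond
    (hlev : ∀ i : J,
      (AlgPoints.map q ((𝒜.baseChange (𝓨.genericIso'.inv.left ≫ pullback.fst 𝓨.total.hom (specGenericPoint (valuationSubringAtPrime K v) K))).restrictPt x.left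
          (𝒜.sectionBaseChange (𝓨.genericIso'.inv.left ≫ pullback.fst 𝓨.total.hom (specGenericPoint (valuationSubringAtPrime K v) K)) (τ i))) :
          B.toAffine.toAbelianVariety.Points (AlgebraicClosure (v.adicCompletion K))) =
        AlgPoints.map c ((𝒜.baseChange (𝓨.genericIso'.inv.left ≫ pullback.fst 𝓨.total.hom (specGenericPoint (valuationSubringAtPrime K v) K))).restrictPt x''.left
          (𝒜.sectionBaseChange (𝓨.genericIso'.inv.left ≫ pullback.fst 𝓨.total.hom (specGenericPoint (valuationSubringAtPrime K v) K)) (τ i)))) :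
    ∃ (qbar : ((𝒜.baseChange (pullback.fst 𝓨.total.hom (specResidueField v))).baseChange (𝓨.geomReductionMap x).left).X ⟶
               (((serreTensor act E' hE').baseChange (pullback.fst 𝓨.total.hom (specResidueField v))).baseChange (𝓨.geomReductionMap x'').left).X)
      (_ : IsMonHom qbar),
      -- (r1₀)
      (Flat qbar.left ∧ Function.Surjective qbar.left.base) ∧
      -- (r4₀-q)
      (∀ a : O, ((act.baseChange (pullback.fst 𝓨.total.hom (specResidueField v))).baseChange (𝓨.geomReductionMap x).left).i a ≫ qbar =
        qbar ≫ (((serreAction act E' hE').baseChange (pullback.fst 𝓨.total.hom (specResidueField v))).baseChange (𝓨.geomReductionMap x'').left).i a) ∧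
      -- (r5₀-q)
      (∀ i : J,
        AlgPoints.map qbar ((𝒜.baseChange (pullback.fst 𝓨.total.hom (specResidueField v))).restrictPt (𝓨.geomReductionMap x).left
            (𝒜.sectionBaseChange (pullback.fst 𝓨.total.hom (specResidueField v)) (τ i))) =
          ((serreTensor act E' hE').baseChange (pullback.fst 𝓨.total.hom (specResidueField v))).restrictPt (𝓨.geomReductionMap x'').left
            ((serreTensor act E' hE').sectionBaseChange (pullback.fst 𝓨.total.hom (specResidueField v)) (τ i ≫ serreTranslate act E' hE' P))) ∧
      -- (r3₀-q) for ANY downstairs dual pair `DB̄` of the Serre fibre (unit pin) and dual homomorphism `λ_B̄` through which the cover leg `c̄` pulls back to `N·λ_{x̄″}`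
      (∀ (DBs : (((serreTensor act E' hE').baseChange (pullback.fst 𝓨.total.hom (specResidueField v))).baseChange (𝓨.geomReductionMap x'').left).DualPair)
        (_ : Nonempty ((Scheme.Modules.pullback (DualPair.unitHatSlice DBs)).obj DBs.P ≅ SheafOfModules.unit _))
        (lamBs : (((serreTensor act E' hE').baseChange (pullback.fst 𝓨.total.hom (specResidueField v))).baseChange (𝓨.geomReductionMap x'').left).X ⟶ DBs.hat.X) [IsMonHom lamBs],
        (haveI := isMonHom_coverLeg (pullback.fst 𝓨.total.hom (specResidueField v)) (𝓨.geomReductionMap x'').left act E' hE' P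
         baseChangeHom (baseChangeHom (serreTranslate act E' hE' P) (pullback.fst 𝓨.total.hom (specResidueField v))) (𝓨.geomReductionMap x'').left ≫ lamBs ≫
            DualPair.dualIsogenyOver (baseChangeHom (baseChangeHom (serreTranslate act E' hE' P) (pullback.fst 𝓨.total.hom (specResidueField v))) (𝓨.geomReductionMap x'').left)
              ((D.baseChange (pullback.fst 𝓨.total.hom (specResidueField v))).baseChange (𝓨.geomReductionMap x'').left) DBs =
          ((pol.baseChange (pullback.fst 𝓨.total.hom (specResidueField v))).baseChange (𝓨.geomReductionMap x'').left).lam ≫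
            ((D.baseChange (pullback.fst 𝓨.total.hom (specResidueField v))).baseChange (𝓨.geomReductionMap x'').left).hat.mulN N) →
        qbar ≫ lamBs ≫ DualPair.dualIsogenyOver qbar ((D.baseChange (pullback.fst 𝓨.total.hom (specResidueField v))).baseChange (𝓨.geomReductionMap x).left) DBs =
          ((pol.baseChange (pullback.fst 𝓨.total.hom (specResidueField v))).baseChange (𝓨.geomReductionMap x).left).lam ≫
            ((D.baseChange (pullback.fst 𝓨.total.hom (specResidueField v))).baseChange (𝓨.geomReductionMap x).left).hat.mulN N) ∧
      -- (K3-gen) [★ (ν8R) (v-b) through ★ organ #2's `E`] KILL along a flat `𝒦 ↪ 𝒜_x̃` over the valuation ring `R = 𝒪_Ω̄` of the point `x` (`x̃` the `R`-point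
      -- extending `x`): if `𝒦_η`, read in `(𝒜_η)_x` through the three-piece isomorphism of ★ (d5), is killed by the LEG `q` (target `B`), then `𝒦_s`, read in `(𝒜_s)_x̄`, is killed by `q̄`
      (∀ (𝒦 : Over (Spec (.of (closureValuationSubring (v.adicCompletion K))))) (incl : 𝒦 ⟶ (𝒜.baseChange (extendPoint (closureValuationSubring (v.adicCompletion K)) (toClosureValuationSubring v) 𝓨.total (𝓨.modelPointsEquiv.symm x)).left).X) [Flat 𝒦.hom],
        ((Over.pullback (specFractionFieldι (closureValuationSubring (v.adicCompletion K)) (toClosureValuationSubring v)).left).map incl ≫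
            (𝒜.fibreBaseChangeIso (𝓨.genericIso'.inv.left ≫ pullback.fst 𝓨.total.hom (specGenericPoint (valuationSubringAtPrime K v) K)) x.left ≪≫ 𝒜.fibreCongrPtIso (𝓨.left_specFractionFieldι_comp_extendPoint_modelPointsEquiv_symm x).symm ≪≫ (𝒜.fibreBaseChangeIso (extendPoint (closureValuationSubring (v.adicCompletion K)) (toClosureValuationSubring v) 𝓨.total (𝓨.modelPointsEquiv.symm x)).left (specFractionFieldι (closureValuationSubring (v.adicCompletion K)) (toClosureValuationSubring v)).left).symm).inv.hom.hom.hom) ≫ q = 1 →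
        ((Over.pullback ((geomClosedPointIsoSpecResidueField v).inv.left ≫ (specRingHomι (closureValuationSubring (v.adicCompletion K)) (toClosureValuationSubring v) (IsLocalRing.residue (closureValuationSubring (v.adicCompletion K)))).left)).map incl ≫
            (𝒜.fibreBaseChangeIso (pullback.fst 𝓨.total.hom (specResidueField v)) (𝓨.geomReductionMap x).left ≪≫ 𝒜.fibreCongrPtIso ((𝓨.left_geomReductionMap_comp_fst x).trans (Category.assoc _ _ _).symm) ≪≫ (𝒜.fibreBaseChangeIso (extendPoint (closureValuationSubring (v.adicCompletion K)) (toClosureValuationSubring v) 𝓨.total (𝓨.modelPointsEquiv.symm x)).left ((geomClosedPointIsoSpecResidueField v).inv.left ≫ (specRingHomι (closureValuationSubring (v.adicCompletion K)) (toClosureValuationSubring v) (IsLocalRing.residue (closureValuationSubring (v.adicCompletion K)))).left)).symm).inv.hom.hom.hom) ≫ qbar = 1) ∧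
      -- (K2-gen) [★ (ν8k-b) (v-b), `Ω̄`-points premiss] for every ideal `𝔞` of `𝒪`: if every `Ω̄`-point of `𝒜_x` killed by `q` is killed by `ι(𝔞)`, then every `T`-valued point of
      -- `𝒜_{x̄}` killed by `q̄` is killed by `ι(𝔞)` (upstairs upgrade to `T`-points: `q′ = q ≫ E⁻¹` is an isogeny in characteristic `0`, ★ `EtaleKernelDecidedOnPoints`)
      (∀ 𝔞 : Ideal O,
        (∀ Pt : ((𝒜.baseChange (𝓨.genericIso'.inv.left ≫ pullback.fst 𝓨.total.hom (specGenericPoint (valuationSubringAtPrime K v) K))).baseChange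
            x.left).toAffine.toAbelianVariety.Points (AlgebraicClosure (v.adicCompletion K)),
          (AlgPoints.map q Pt : B.toAffine.toAbelianVariety.Points (AlgebraicClosure (v.adicCompletion K))) = 1 →
            ∀ r ∈ 𝔞, (AlgPoints.map (((act.baseChange (𝓨.genericIso'.inv.left ≫ pullback.fst 𝓨.total.hom (specGenericPoint (valuationSubringAtPrime K v) K))).baseChange x.left).i r) Pt :
              ((𝒜.baseChange (𝓨.genericIso'.inv.left ≫ pullback.fst 𝓨.total.hom (specGenericPoint (valuationSubringAtPrime K v) K))).baseChange
                x.left).toAffine.toAbelianVariety.Points (AlgebraicClosure (v.adicCompletion K))) = 1) →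
        ∀ ⦃T : Over (Spec (.of (geomResidueField v)))⦄ (z : T ⟶ ((𝒜.baseChange (pullback.fst 𝓨.total.hom (specResidueField v))).baseChange (𝓨.geomReductionMap x).left).X),
          z ≫ qbar = 1 → ∀ r ∈ 𝔞, z ≫ ((act.baseChange (pullback.fst 𝓨.total.hom (specResidueField v))).baseChange (𝓨.geomReductionMap x).left).i r = 1) ∧
      -- (K4-gen) [★ `…KernelRowsDeg` (K4) through ★ organ #2's `E`] the DEGREE of the reduced leg is the degree of `q`
      AbelianVariety.Hom.kerRank (homOfIsMonHom qbar) = AbelianVariety.Hom.kerRank (homOfIsMonHom q) ∧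
      -- (FIN) [★ `…KernelRowsFin` (i⁺)] the reduced leg is FINITE (an isogeny, with (r1₀))
      IsFinite qbar.left ∧
      -- (RK) the RANK COUNT `rk Γ(Ker q̄) = #Ker q(Ω̄)` (★ `finrank_alg_ker_eq_natCard_kerPoints_of_kerRank_eq` on (K4-gen) + (FIN) + (r1₀); `q` is étale upstairs, char 0)
      Module.finrank (geomResidueField v) (Literature.AlgebraicGeometry.GroupSchemes.AffineGroupScheme.Alg (Literature.AlgebraicGeometry.GroupSchemes.GroupSchemeKernel.ker qbar)) =
        Nat.card (AbelianVariety.Hom.kerPoints (specOver (AlgebraicClosure (v.adicCompletion K)) (AlgebraicClosure (v.adicCompletion K))) (homOfIsMonHom q)) ∧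
      -- (IMG-gen) [★ image head (v-c), A-p06 (g36)] IMAGE ∕ FACTORISATION in ROOF currency along a flat `𝒦 ↪ 𝒜_x̃` INTO `c̄(𝒵)` for a model subscheme `ζ : 𝒵 → 𝒜_x̃″` (`x̃″` the `R`-point
      -- extending `x″`) with `ζ ≫ (ψ_P ×_𝓨 x̃″)` a CLOSED immersion: if `incl_η ≫ e⁻¹ ≫ q` factors through `ζ_η ≫ e⁻¹ ≫ c` (LEGS `q`, `c`, target `B`), then `incl_s̄ ≫ e⁻¹ ≫ q̄`
      -- factors through `ζ_s̄ ≫ e⁻¹ ≫ c̄_{x̄″}` (`c̄_{x̄″} = ψ_P` at `x̄″`); three-piece isomorphisms `e` of `𝒜` at `x` and at `x″` explicit, as in (K3-gen)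
      (∀ (𝒦 : Over (Spec (.of (closureValuationSubring (v.adicCompletion K))))) (incl : 𝒦 ⟶ (𝒜.baseChange (extendPoint (closureValuationSubring (v.adicCompletion K)) (toClosureValuationSubring v) 𝓨.total (𝓨.modelPointsEquiv.symm x)).left).X) [Flat 𝒦.hom]
        (𝒵 : Over (Spec (.of (closureValuationSubring (v.adicCompletion K))))) (ζ : 𝒵 ⟶ (𝒜.baseChange (extendPoint (closureValuationSubring (v.adicCompletion K)) (toClosureValuationSubring v) 𝓨.total (𝓨.modelPointsEquiv.symm x'')).left).X) [IsClosedImmersion (ζ ≫ baseChangeHom (serreTranslate act E' hE' P) (extendPoint (closureValuationSubring (v.adicCompletion K)) (toClosureValuationSubring v) 𝓨.total (𝓨.modelPointsEquiv.symm x'')).left).left],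
        (∃ m : (Over.pullback (specFractionFieldι (closureValuationSubring (v.adicCompletion K)) (toClosureValuationSubring v)).left).obj 𝒦 ⟶ (Over.pullback (specFractionFieldι (closureValuationSubring (v.adicCompletion K)) (toClosureValuationSubring v)).left).obj 𝒵,
          m ≫ (((Over.pullback (specFractionFieldι (closureValuationSubring (v.adicCompletion K)) (toClosureValuationSubring v)).left).map ζ ≫ (𝒜.fibreBaseChangeIso (𝓨.genericIso'.inv.left ≫ pullback.fst 𝓨.total.hom (specGenericPoint (valuationSubringAtPrime K v) K)) x''.left ≪≫ 𝒜.fibreCongrPtIso (𝓨.left_specFractionFieldι_comp_extendPoint_modelPointsEquiv_symm x'').symm ≪≫ (𝒜.fibreBaseChangeIso (extendPoint (closureValuationSubring (v.adicCompletion K)) (toClosureValuationSubring v) 𝓨.total (𝓨.modelPointsEquiv.symm x'')).left (specFractionFieldι (closureValuationSubring (v.adicCompletion K)) (toClosureValuationSubring v)).left).symm).inv.hom.hom.hom) ≫ c) =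
            ((Over.pullback (specFractionFieldι (closureValuationSubring (v.adicCompletion K)) (toClosureValuationSubring v)).left).map incl ≫ (𝒜.fibreBaseChangeIso (𝓨.genericIso'.inv.left ≫ pullback.fst 𝓨.total.hom (specGenericPoint (valuationSubringAtPrime K v) K)) x.left ≪≫ 𝒜.fibreCongrPtIso (𝓨.left_specFractionFieldι_comp_extendPoint_modelPointsEquiv_symm x).symm ≪≫ (𝒜.fibreBaseChangeIso (extendPoint (closureValuationSubring (v.adicCompletion K)) (toClosureValuationSubring v) 𝓨.total (𝓨.modelPointsEquiv.symm x)).left (specFractionFieldι (closureValuationSubring (v.adicCompletion K)) (toClosureValuationSubring v)).left).symm).inv.hom.hom.hom) ≫ q) →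
        ∃ m : (Over.pullback ((geomClosedPointIsoSpecResidueField v).inv.left ≫ (specRingHomι (closureValuationSubring (v.adicCompletion K)) (toClosureValuationSubring v) (IsLocalRing.residue (closureValuationSubring (v.adicCompletion K)))).left)).obj 𝒦 ⟶ (Over.pullback ((geomClosedPointIsoSpecResidueField v).inv.left ≫ (specRingHomι (closureValuationSubring (v.adicCompletion K)) (toClosureValuationSubring v) (IsLocalRing.residue (closureValuationSubring (v.adicCompletion K)))).left)).obj 𝒵,
          m ≫ (((Over.pullback ((geomClosedPointIsoSpecResidueField v).inv.left ≫ (specRingHomι (closureValuationSubring (v.adicCompletion K)) (toClosureValuationSubring v) (IsLocalRing.residue (closureValuationSubring (v.adicCompletion K)))).left)).map ζ ≫ (𝒜.fibreBaseChangeIso (pullback.fst 𝓨.total.hom (specResidueField v)) (𝓨.geomReductionMap x'').left ≪≫ 𝒜.fibreCongrPtIso ((𝓨.left_geomReductionMap_comp_fst x'').trans (Category.assoc _ _ _).symm) ≪≫ (𝒜.fibreBaseChangeIso (extendPoint (closureValuationSubring (v.adicCompletion K)) (toClosureValuationSubring v) 𝓨.total (𝓨.modelPointsEquiv.symm x'')).left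 ((geomClosedPointIsoSpecResidueField v).inv.left ≫ (specRingHomι (closureValuationSubring (v.adicCompletion K)) (toClosureValuationSubring v) (IsLocalRing.residue (closureValuationSubring (v.adicCompletion K)))).left)).symm).inv.hom.hom.hom) ≫ baseChangeHom (baseChangeHom (serreTranslate act E' hE' P) (pullback.fst 𝓨.total.hom (specResidueField v))) (𝓨.geomReductionMap x'').left) =
            ((Over.pullback ((geomClosedPointIsoSpecResidueField v).inv.left ≫ (specRingHomι (closureValuationSubring (v.adicCompletion K)) (toClosureValuationSubring v) (IsLocalRing.residue (closureValuationSubring (v.adicCompletion K)))).left)).map incl ≫ (𝒜.fibreBaseChangeIso (pullback.fst 𝓨.total.hom (specResidueField v)) (𝓨.geomReductionMap x).left ≪≫ 𝒜.fibreCongrPtIso ((𝓨.left_geomReductionMap_comp_fst x).trans (Category.assoc _ _ _).symm) ≪≫ (𝒜.fibreBaseChangeIso (extendPoint (closureValuationSubring (v.adicCompletion K)) (toClosureValuationSubring v) 𝓨.total (𝓨.modelPointsEquiv.symm x)).left ((geomClosedPointIsoSpecResidueField v).inv.left ≫ (specRingHomι (closureValuationSubring (v.adicCompletion K)) (toClosureValuationSubring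 v) (IsLocalRing.residue (closureValuationSubring (v.adicCompletion K)))).left)).symm).inv.hom.hom.hom) ≫ qbar) := by
  haveI := isMonHom_serreTranslate act E' hE' P
  haveI := isMonHom_serreTranslateInv act E' hE' Q
  haveI := pol.isMonHom
  haveI : CharZero (v.adicCompletion K) := charZero_of_injective_algebraMap (algebraMap K (v.adicCompletion K)).injective
  haveI : IsLocallyNoetherian (specOver K (AlgebraicClosure (v.adicCompletion K))).left :=
    inferInstanceAs (IsLocallyNoetherian (Spec (.of (AlgebraicClosure (v.adicCompletion K)))))
  haveI : IsReduced (specOver K (AlgebraicClosure (v.adicCompletion K))).left :=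
    inferInstanceAs (IsReduced (Spec (.of (AlgebraicClosure (v.adicCompletion K)))))
  haveI : IsLocallyNoetherian (specOver v.asIdeal.ResidueField (geomResidueField v)).left :=
    inferInstanceAs (IsLocallyNoetherian (Spec (.of (geomResidueField v))))
  haveI : IsReduced (specOver v.asIdeal.ResidueField (geomResidueField v)).left :=
    inferInstanceAs (IsReduced (Spec (.of (geomResidueField v))))
  -- STEP 1 (★ organ #2): the middle is the Serre-family fibre, `E : 𝒞_{x″} ≅ B` with `c̄ ≫ E = c`
  obtain ⟨E, hE, hEmon, hEinv, -⟩ := exists_iso_coverLeg_comp_eq_of_forall_points_of_charZero (𝓨.genericIso'.inv.left ≫ pullback.fst 𝓨.total.hom (specGenericPoint (valuationSubringAtPrime K v) K)) x''.left act E' hE' P Q c hN hP hQ hQP hPQ h𝔭 hker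
  haveI := hEmon
  haveI := hEinv
  -- the cover leg and the cover at the generic iterated base change (★ organ #1 ∕ #2)
  haveI hψmon := isMonHom_coverLeg (𝓨.genericIso'.inv.left ≫ pullback.fst 𝓨.total.hom (specGenericPoint (valuationSubringAtPrime K v) K)) x''.left act E' hE' P
  haveI := flat_coverLeg_left (𝓨.genericIso'.inv.left ≫ pullback.fst 𝓨.total.hom (specGenericPoint (valuationSubringAtPrime K v) K)) x''.left act E' hE' P Q hN hP hQ hQP hPQ
  haveI := surjective_coverLeg_left (𝓨.genericIso'.inv.left ≫ pullback.fst 𝓨.total.hom (specGenericPoint (valuationSubringAtPrime K v) K)) x''.left act E' hE' P Q hN hP hQ hQP hPQ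
  haveI := isFinite_coverLeg_left (𝓨.genericIso'.inv.left ≫ pullback.fst 𝓨.total.hom (specGenericPoint (valuationSubringAtPrime K v) K)) x''.left act E' hE' P Q hN hP hQ hQP hPQ
  haveI : QuasiCompact (baseChangeHom (baseChangeHom (serreTranslate act E' hE' P) (𝓨.genericIso'.inv.left ≫ pullback.fst 𝓨.total.hom (specGenericPoint (valuationSubringAtPrime K v) K))) x''.left).left := inferInstance
  haveI : IsMonHom (baseChangeHom (baseChangeHom (serreTranslateInv act E' hE' Q) (𝓨.genericIso'.inv.left ≫ pullback.fst 𝓨.total.hom (specGenericPoint (valuationSubringAtPrime K v) K))) x''.left) :=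
    (haveI := isMonHom_baseChangeHom (serreTranslateInv act E' hE' Q) (𝓨.genericIso'.inv.left ≫ pullback.fst 𝓨.total.hom (specGenericPoint (valuationSubringAtPrime K v) K)); isMonHom_baseChangeHom _ x''.left)
  -- STEP 2: `q′ := q ≫ E⁻¹`, finite surjective
  haveI : IsFinite (q ≫ E.inv).left := isFinite_retarget_left q E
  haveI : Surjective (q ≫ E.inv).left := surjective_retarget_left q E
  -- STEP 3 (★ `exists_specialFibre_hom_reduction_kerRowsFin_image`): reduce `q′` ONCE, keeping (iv-h), the model KILL (v-b-model), the ideal bound (K2), the degree (K4), the finiteness (i⁺) and the factorisation (v-c)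
  obtain ⟨qbar, hqmon, h1, h2, h3, -, h5, h6, -, h8, h9, h10, h11⟩ := exists_specialFibre_hom_reduction_kerRowsFin_image 𝓨 𝒜 (serreTensor act E' hE') x x'' (q ≫ E.inv) act
  haveI := hqmon
  -- (K4-gen) and (FIN) first, as named facts (the (RK) row consumes them)
  have hK4 : AbelianVariety.Hom.kerRank (homOfIsMonHom qbar) = AbelianVariety.Hom.kerRank (homOfIsMonHom q) := by
    rw [h9 inferInstance inferInstance, homOfIsMonHom_comp q E.inv]
    have hq : AbelianVariety.IsIsogeny (homOfIsMonHom q) := ⟨‹Surjective q.left›, ‹IsFinite q.left›⟩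
    haveI : IsIso (AbelianVariety.Hom.toSchemeHom (homOfIsMonHom E.inv)) := inferInstanceAs (IsIso ((Over.forget _).map E.inv))
    have hEi := isIsogeny_and_kerRank_of_isIso_toSchemeHom_fi (homOfIsMonHom E.inv)
    rw [hq.kerRank_comp hEi.1, hEi.2, mul_one]
  have hfinq : IsFinite qbar.left := h10 inferInstance inferInstance
  refine ⟨qbar, hqmon, h1 inferInstance inferInstance, ?_, ?_, ?_, ?_, ?_, hK4, hfinq, ?_, ?_⟩
  · -- (r4₀-q): common intertwiners re-target (★ organ #2) then transfer (★ (ν8)(ii))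
    intro a
    haveI := act.isMonHom a
    haveI := (serreAction act E' hE').isMonHom a
    obtain ⟨b, hqb, hcb⟩ := hb a
    exact h2 (act.i a) ((serreAction act E' hE').i a)
      (i_comp_retarget_of_common_intertwiner q c (baseChangeHom (baseChangeHom (serreTranslate act E' hE' P) (𝓨.genericIso'.inv.left ≫ pullback.fst 𝓨.total.hom (specGenericPoint (valuationSubringAtPrime K v) K))) x''.left) E hE hqb hcb
        (i_comp_coverLeg (𝓨.genericIso'.inv.left ≫ pullback.fst 𝓨.total.hom (specGenericPoint (valuationSubringAtPrime K v) K)) x''.left act E' hE' P hP a))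
  · -- (r5₀-q): point identities re-target (★ organ #2) then transfer (★ (ν8)(iii)) — sections edition
    intro i
    have hup : AlgPoints.map (q ≫ E.inv) ((𝒜.baseChange (𝓨.genericIso'.inv.left ≫ pullback.fst 𝓨.total.hom (specGenericPoint (valuationSubringAtPrime K v) K))).restrictPt x.left (𝒜.sectionBaseChange (𝓨.genericIso'.inv.left ≫ pullback.fst 𝓨.total.hom (specGenericPoint (valuationSubringAtPrime K v) K)) (τ i))) =
        ((serreTensor act E' hE').baseChange (𝓨.genericIso'.inv.left ≫ pullback.fst 𝓨.total.hom (specGenericPoint (valuationSubringAtPrime K v) K))).restrictPt x''.left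
          ((serreTensor act E' hE').sectionBaseChange (𝓨.genericIso'.inv.left ≫ pullback.fst 𝓨.total.hom (specGenericPoint (valuationSubringAtPrime K v) K)) (τ i ≫ serreTranslate act E' hE' P)) := by
      rw [map_retarget_eq_map q c (baseChangeHom (baseChangeHom (serreTranslate act E' hE' P) (𝓨.genericIso'.inv.left ≫ pullback.fst 𝓨.total.hom (specGenericPoint (valuationSubringAtPrime K v) K))) x''.left) E hE _ _ (hlev i),
        sectionBaseChange_comp, ← map_fibreHom_restrictPt x''.left (baseChangeHom (serreTranslate act E' hE' P) (𝓨.genericIso'.inv.left ≫ pullback.fst 𝓨.total.hom (specGenericPoint (valuationSubringAtPrime K v) K)))]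
      rfl
    exact h3 (τ i) (τ i ≫ serreTranslate act E' hE' P) hup
  · -- (r3₀-q) THROUGH `𝒜`: upstairs multiply (§1) → (iv-h) → downstairs divide (§1)
    intro DBs hDBs lamBs _ hc3s
    -- unit pins of the base-changed dual pairs of `𝒜`
    have hDηx := DualPair.nonempty_unitHatSlice_baseChange_iso (g := x.left) _ (DualPair.nonempty_unitHatSlice_baseChange_iso (g := (𝓨.genericIso'.inv.left ≫ pullback.fst 𝓨.total.hom (specGenericPoint (valuationSubringAtPrime K v) K))) D hD)
    have hDη'' := DualPair.nonempty_unitHatSlice_baseChange_iso (g := x''.left) _ (DualPair.nonempty_unitHatSlice_baseChange_iso (g := (𝓨.genericIso'.inv.left ≫ pullback.fst 𝓨.total.hom (specGenericPoint (valuationSubringAtPrime K v) K))) D hD)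
    have hDs := DualPair.nonempty_unitHatSlice_baseChange_iso (g := (𝓨.geomReductionMap x).left) _ (DualPair.nonempty_unitHatSlice_baseChange_iso (g := (pullback.fst 𝓨.total.hom (specResidueField v))) D hD)
    have hDs'' := DualPair.nonempty_unitHatSlice_baseChange_iso (g := (𝓨.geomReductionMap x'').left) _ (DualPair.nonempty_unitHatSlice_baseChange_iso (g := (pullback.fst 𝓨.total.hom (specResidueField v))) D hD)
    haveI := ((pol.baseChange (𝓨.genericIso'.inv.left ≫ pullback.fst 𝓨.total.hom (specGenericPoint (valuationSubringAtPrime K v) K))).baseChange x.left).isMonHom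
    haveI := ((pol.baseChange (𝓨.genericIso'.inv.left ≫ pullback.fst 𝓨.total.hom (specGenericPoint (valuationSubringAtPrime K v) K))).baseChange x''.left).isMonHom
    haveI := ((pol.baseChange (pullback.fst 𝓨.total.hom (specResidueField v))).baseChange (𝓨.geomReductionMap x).left).isMonHom
    haveI := ((pol.baseChange (pullback.fst 𝓨.total.hom (specResidueField v))).baseChange (𝓨.geomReductionMap x'').left).isMonHom
    haveI : IsCommMonObj B.X := B.isCommMonObj_of_isReduced_base
    haveI : IsMonHom (B.mulN N) := B.isMonHom_mulN N
    -- `c` is fppf (it is `c̄_η ≫ E`)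
    haveI : Flat c.left := by rw [← hE]; exact flat_retarget_left (baseChangeHom (baseChangeHom (serreTranslate act E' hE' P) (𝓨.genericIso'.inv.left ≫ pullback.fst 𝓨.total.hom (specGenericPoint (valuationSubringAtPrime K v) K))) x''.left) E.symm
    haveI : IsFinite c.left := by
      rw [← hE]; exact isFinite_retarget_left (baseChangeHom (baseChangeHom (serreTranslate act E' hE' P) (𝓨.genericIso'.inv.left ≫ pullback.fst 𝓨.total.hom (specGenericPoint (valuationSubringAtPrime K v) K))) x''.left) E.symm
    haveI : QuasiCompact c.left := inferInstance
    -- UPSTAIRS: `d := E⁻¹ ≫ ψ′_{x″}` is a quasi-inverse of `c`: `c ≫ d = [N]`, `d ≫ c = [N]`, hence `c^∨ ≫ d^∨ = [N]`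
    have hcd : c ≫ (E.inv ≫ baseChangeHom (baseChangeHom (serreTranslateInv act E' hE' Q) (𝓨.genericIso'.inv.left ≫ pullback.fst 𝓨.total.hom (specGenericPoint (valuationSubringAtPrime K v) K))) x''.left) =
        (𝟙 ((𝒜.baseChange (𝓨.genericIso'.inv.left ≫ pullback.fst 𝓨.total.hom (specGenericPoint (valuationSubringAtPrime K v) K))).baseChange x''.left).X) ^ N := by
      rw [← hE, Category.assoc, E.hom_inv_id_assoc]
      exact baseChangeHom_comp_eq_pow_id_of_comp_eq_pow_id x''.left _ _
        (baseChangeHom_comp_eq_pow_id_of_comp_eq_pow_id (𝓨.genericIso'.inv.left ≫ pullback.fst 𝓨.total.hom (specGenericPoint (valuationSubringAtPrime K v) K)) _ _ (serreTranslate_comp_serreTranslateInv act E' hE' P Q hP hQ hQP))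
    have hdc : (E.inv ≫ baseChangeHom (baseChangeHom (serreTranslateInv act E' hE' Q) (𝓨.genericIso'.inv.left ≫ pullback.fst 𝓨.total.hom (specGenericPoint (valuationSubringAtPrime K v) K))) x''.left) ≫ c = B.mulN N := by
      rw [← hE, Category.assoc, ← Category.assoc (baseChangeHom (baseChangeHom (serreTranslateInv act E' hE' Q) (𝓨.genericIso'.inv.left ≫ pullback.fst 𝓨.total.hom (specGenericPoint (valuationSubringAtPrime K v) K))) x''.left),
        coverLegInv_comp_coverLeg (𝓨.genericIso'.inv.left ≫ pullback.fst 𝓨.total.hom (specGenericPoint (valuationSubringAtPrime K v) K)) x''.left act E' hE' P Q hP hQ hPQ, ← Category.assoc, comp_pow_id_eq_pow_id_comp B E.inv N,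
        Category.assoc, E.inv_hom_id, Category.comp_id, mulN_def]
    have hχ : DualPair.dualIsogenyOver c ((D.baseChange (𝓨.genericIso'.inv.left ≫ pullback.fst 𝓨.total.hom (specGenericPoint (valuationSubringAtPrime K v) K))).baseChange x''.left) DB ≫
        DualPair.dualIsogenyOver (E.inv ≫ baseChangeHom (baseChangeHom (serreTranslateInv act E' hE' Q) (𝓨.genericIso'.inv.left ≫ pullback.fst 𝓨.total.hom (specGenericPoint (valuationSubringAtPrime K v) K))) x''.left) DB ((D.baseChange (𝓨.genericIso'.inv.left ≫ pullback.fst 𝓨.total.hom (specGenericPoint (valuationSubringAtPrime K v) K))).baseChange x''.left) =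
        (𝟙 DB.hat.X) ^ N := by
      rw [← DualPair.dualIsogenyOver_comp _ _ DB ((D.baseChange (𝓨.genericIso'.inv.left ≫ pullback.fst 𝓨.total.hom (specGenericPoint (valuationSubringAtPrime K v) K))).baseChange x''.left) DB,
        DualPair.dualIsogenyOver_congr DB DB (ψ₂ := B.mulN N) (h₂ := inferInstance) hdc, DualPair.dualIsogenyOver_mulN DB hDB N, mulN_def]
    have hup := comp_comp_lam_comp_dualIsogenyOver_of_quasiInverse ((D.baseChange (𝓨.genericIso'.inv.left ≫ pullback.fst 𝓨.total.hom (specGenericPoint (valuationSubringAtPrime K v) K))).baseChange x.left) ((D.baseChange (𝓨.genericIso'.inv.left ≫ pullback.fst 𝓨.total.hom (specGenericPoint (valuationSubringAtPrime K v) K))).baseChange x''.left) DB hDηx hDη'' hDB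
      c (E.inv ≫ baseChangeHom (baseChangeHom (serreTranslateInv act E' hE' Q) (𝓨.genericIso'.inv.left ≫ pullback.fst 𝓨.total.hom (specGenericPoint (valuationSubringAtPrime K v) K))) x''.left)
      ((pol.baseChange (𝓨.genericIso'.inv.left ≫ pullback.fst 𝓨.total.hom (specGenericPoint (valuationSubringAtPrime K v) K))).baseChange x.left).lam ((pol.baseChange (𝓨.genericIso'.inv.left ≫ pullback.fst 𝓨.total.hom (specGenericPoint (valuationSubringAtPrime K v) K))).baseChange x''.left).lam lamB hN hcd hχ hc3 q hq3
      ((q ≫ E.inv) ≫ baseChangeHom (baseChangeHom (serreTranslateInv act E' hE' Q) (𝓨.genericIso'.inv.left ≫ pullback.fst 𝓨.total.hom (specGenericPoint (valuationSubringAtPrime K v) K))) x''.left) (Category.assoc _ _ _)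
    -- TRANSFER (★ (ν8h) (iv-h)) with `ℰ := 𝒜`, `h := ψ′`
    haveI : IsMonHom (baseChangeHom (baseChangeHom (serreTranslateInv act E' hE' Q) (pullback.fst 𝓨.total.hom (specResidueField v))) (𝓨.geomReductionMap x'').left) :=
      (haveI := isMonHom_baseChangeHom (serreTranslateInv act E' hE' Q) (pullback.fst 𝓨.total.hom (specResidueField v)); isMonHom_baseChangeHom _ (𝓨.geomReductionMap x'').left)
    have hdown := h5 𝒜 (serreTranslateInv act E' hE' Q) ((q ≫ E.inv) ≫ baseChangeHom (baseChangeHom (serreTranslateInv act E' hE' Q) (𝓨.genericIso'.inv.left ≫ pullback.fst 𝓨.total.hom (specGenericPoint (valuationSubringAtPrime K v) K))) x''.left) rfl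
      D pol D pol (N * N) hup (qbar ≫ baseChangeHom (baseChangeHom (serreTranslateInv act E' hE' Q) (pullback.fst 𝓨.total.hom (specResidueField v))) (𝓨.geomReductionMap x'').left) rfl
    -- DOWNSTAIRS: `ψ′_{x̄″}` is a quasi-inverse of the cover leg `c̄` (★ organ #1 ∕ #2), divide by `[N]`
    haveI := isMonHom_coverLeg (pullback.fst 𝓨.total.hom (specResidueField v)) (𝓨.geomReductionMap x'').left act E' hE' P
    haveI := flat_coverLeg_left (pullback.fst 𝓨.total.hom (specResidueField v)) (𝓨.geomReductionMap x'').left act E' hE' P Q hN hP hQ hQP hPQ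
    haveI := surjective_coverLeg_left (pullback.fst 𝓨.total.hom (specResidueField v)) (𝓨.geomReductionMap x'').left act E' hE' P Q hN hP hQ hQP hPQ
    haveI := isFinite_coverLeg_left (pullback.fst 𝓨.total.hom (specResidueField v)) (𝓨.geomReductionMap x'').left act E' hE' P Q hN hP hQ hQP hPQ
    haveI : QuasiCompact (baseChangeHom (baseChangeHom (serreTranslate act E' hE' P) (pullback.fst 𝓨.total.hom (specResidueField v))) (𝓨.geomReductionMap x'').left).left := inferInstance
    have hcds : baseChangeHom (baseChangeHom (serreTranslate act E' hE' P) (pullback.fst 𝓨.total.hom (specResidueField v))) (𝓨.geomReductionMap x'').left ≫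
        baseChangeHom (baseChangeHom (serreTranslateInv act E' hE' Q) (pullback.fst 𝓨.total.hom (specResidueField v))) (𝓨.geomReductionMap x'').left =
        (𝟙 ((𝒜.baseChange (pullback.fst 𝓨.total.hom (specResidueField v))).baseChange (𝓨.geomReductionMap x'').left).X) ^ N :=
      baseChangeHom_comp_eq_pow_id_of_comp_eq_pow_id (𝓨.geomReductionMap x'').left _ _
        (baseChangeHom_comp_eq_pow_id_of_comp_eq_pow_id (pullback.fst 𝓨.total.hom (specResidueField v)) _ _ (serreTranslate_comp_serreTranslateInv act E' hE' P Q hP hQ hQP))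
    have hχs := dualIsogenyOver_coverLeg_comp_eq_pow_id (pullback.fst 𝓨.total.hom (specResidueField v)) (𝓨.geomReductionMap x'').left act E' hE' P Q hP hQ hPQ ((D.baseChange (pullback.fst 𝓨.total.hom (specResidueField v))).baseChange (𝓨.geomReductionMap x'').left) DBs hDBs
    exact comp_lam_comp_dualIsogenyOver_of_postcomp_of_quasiInverse ((D.baseChange (pullback.fst 𝓨.total.hom (specResidueField v))).baseChange (𝓨.geomReductionMap x).left) ((D.baseChange (pullback.fst 𝓨.total.hom (specResidueField v))).baseChange (𝓨.geomReductionMap x'').left) DBs hDs hDs'' hDBs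
      (baseChangeHom (baseChangeHom (serreTranslate act E' hE' P) (pullback.fst 𝓨.total.hom (specResidueField v))) (𝓨.geomReductionMap x'').left) (baseChangeHom (baseChangeHom (serreTranslateInv act E' hE' Q) (pullback.fst 𝓨.total.hom (specResidueField v))) (𝓨.geomReductionMap x'').left)
      ((pol.baseChange (pullback.fst 𝓨.total.hom (specResidueField v))).baseChange (𝓨.geomReductionMap x).left).lam ((pol.baseChange (pullback.fst 𝓨.total.hom (specResidueField v))).baseChange (𝓨.geomReductionMap x'').left).lam lamBs hN hcds hχs hc3s
      qbar (qbar ≫ baseChangeHom (baseChangeHom (serreTranslateInv act E' hE' Q) (pullback.fst 𝓨.total.hom (specResidueField v))) (𝓨.geomReductionMap x'').left) rfl hdown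
  · -- (K3-gen): the model KILL row of the head, for `q′ = q ≫ E⁻¹`; `q` kills ⇒ `q′` kills
    intro 𝒦 incl _ hk
    exact h6 𝒦 incl (by simpa only [Category.assoc, MonObj.one_comp] using congrArg (· ≫ E.inv) hk)
  · -- (K2-gen): the ideal-bound row of the head at `𝔞`, its `T`-points premiss for `q′` obtained from the `Ω̄`-points premiss for `q` (char 0, `q′` an isogeny)
    intro 𝔞 hpts T z hz
    refine h8 inferInstance inferInstance 𝔞 (fun T' t ht r hr => ?_) z hz
    refine comp_eq_one_of_forall_points_of_charZero (q ≫ E.inv)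
      (((act.baseChange (𝓨.genericIso'.inv.left ≫ pullback.fst 𝓨.total.hom (specGenericPoint (valuationSubringAtPrime K v) K))).baseChange x.left).i r) (fun Pt hP => ?_) t ht
    -- `q′(Pt) = 1 ⇒ q(Pt) = 1` (`E` an isomorphism of group schemes)
    have hq1 : (AlgPoints.map q Pt : B.toAffine.toAbelianVariety.Points (AlgebraicClosure (v.adicCompletion K))) = 1 := by
      have e1 : AlgPoints.map q Pt = AlgPoints.map E.hom (AlgPoints.map (q ≫ E.inv) Pt) := by
        rw [← AlgPoints.map_comp_apply, Category.assoc, E.inv_hom_id, Category.comp_id]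
      rw [e1, hP]
      exact MonObj.one_comp E.hom
    exact hpts Pt hq1 r hr

  · -- (RK): `rk Γ(Ker q̄) = #Ker q(Ω̄)` — ★ `finrank_alg_ker_eq_natCard_kerPoints_of_kerRank_eq` (ED. 2 of ★ `RoofLegsSpecialFibreKernelRowsDeg`) on (K4-gen), (FIN), (r1₀)
    exact finrank_alg_ker_eq_natCard_kerPoints_of_kerRank_eq q qbar hK4 hfinq ⟨(h1 inferInstance inferInstance).2⟩
  · -- (IMG-gen): the head's (v-c) for `q′ = q ≫ E⁻¹` at the closed `ζ ≫ c̄_R : 𝒵 → 𝒞_x̃″`; §0 moves `c̄_R` through the three-piece isomorphisms (`ψ_P` is a model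
    -- homomorphism), and upstairs `c̄_{x″} = c ≫ E⁻¹` (★ organ #2: `c̄_{x″} ≫ E = c`)
    intro 𝒦 incl _ 𝒵 ζ _ hfac
    obtain ⟨m, hm⟩ := hfac
    have hcE : baseChangeHom (baseChangeHom (serreTranslate act E' hE' P) (𝓨.genericIso'.inv.left ≫ pullback.fst 𝓨.total.hom (specGenericPoint (valuationSubringAtPrime K v) K))) x''.left = c ≫ E.inv := by
      rw [← hE, Category.assoc, E.hom_inv_id, Category.comp_id]
    have natη := pullback_map_baseChangeHom_comp_threePiece_inv (𝒜 := 𝒜) (𝒞 := serreTensor act E' hE') (serreTranslate act E' hE' P) (𝓨.genericIso'.inv.left ≫ pullback.fst 𝓨.total.hom (specGenericPoint (valuationSubringAtPrime K v) K)) x''.left (extendPoint (closureValuationSubring (v.adicCompletion K)) (toClosureValuationSubring v) 𝓨.total (𝓨.modelPointsEquiv.symm x'')).left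
      (specFractionFieldι (closureValuationSubring (v.adicCompletion K)) (toClosureValuationSubring v)).left (𝓨.left_specFractionFieldι_comp_extendPoint_modelPointsEquiv_symm x'').symm
    have nats := pullback_map_baseChangeHom_comp_threePiece_inv (𝒜 := 𝒜) (𝒞 := serreTensor act E' hE') (serreTranslate act E' hE' P) (pullback.fst 𝓨.total.hom (specResidueField v)) (𝓨.geomReductionMap x'').left (extendPoint (closureValuationSubring (v.adicCompletion K)) (toClosureValuationSubring v) 𝓨.total (𝓨.modelPointsEquiv.symm x'')).left
      ((geomClosedPointIsoSpecResidueField v).inv.left ≫ (specRingHomι (closureValuationSubring (v.adicCompletion K)) (toClosureValuationSubring v) (IsLocalRing.residue (closureValuationSubring (v.adicCompletion K)))).left) ((𝓨.left_geomReductionMap_comp_fst x'').trans (Category.assoc _ _ _).symm)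
    obtain ⟨m', hm'⟩ := h11 𝒦 incl 𝒵 (ζ ≫ baseChangeHom (serreTranslate act E' hE' P) (extendPoint (closureValuationSubring (v.adicCompletion K)) (toClosureValuationSubring v) 𝓨.total (𝓨.modelPointsEquiv.symm x'')).left) ⟨m, by
      have h' := congrArg (· ≫ E.inv) hm
      simp only [Functor.map_comp, Category.assoc] at h' ⊢
      rw [natη, hcE]
      simpa only [Category.assoc] using h'⟩
    simp only [Functor.map_comp, Category.assoc] at hm'
    rw [nats] at hm'
    exact ⟨m', by simpa only [Category.assoc] using hm'⟩

end HeadFinImage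

end AbelianSchemeOver

end Literature.AlgebraicGeometry.AbelianSchemes

end
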